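import Summits.HodgeConjecture.HodgeConjecture.Theorems.MarkmanPartnerTransportK3Sq2OneCycleIsometries

/-!
# Route MarkmanPartnerTransport · the isometry-spanned sector — «TRICHOTOMY»: `SpannedByIsometries` holds EXACTLY
# when the Hodge endomorphisms of `T(X)` are rational scalars or `X` has complex multiplication

Programme «RM-GEN + CELL-SPLIT + RM-EXACT» of the cell hodge-nonav (planner p1 g38 / g39 GO 15:59Z), route-independent
(no `Theses` import; notations copied verbatim: `MarkedK3Sq[…]`, `SpIso[…]` from the route declarations, `CMX[…]` from
`…K3Sq2OneCycle`). For a marked smooth projective `(X, φ, P, z)` (clauses (m1)–(m6); no `K3^{[2]}`-type hypothesis):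

* `eq_ratSmul_on_transcendental_of_apply_period` — a rational, `(1,1)`-type-preserving endomorphism `G` of
  `H²(X(ℂ); ℂ)` with `G σ = a·σ`, `a ∈ ℚ`, acts as the scalar `a` on the `T`-domain `{y : q(φy, φN¹) = 0}` (read `G`
  in `E = End_Hdg(T)` of the period datum, `ε(G|_T) = a = ε(a·1)`, `ε` injective, transport along `ι_T`);
* `apply_conjPeriod_of_apply_period` — such a `G` has `φ(G σ̄) = conj(t) · z̄` when `G σ = t · σ` (a complexified
  RATIONAL endomorphism commutes with complex conjugation, `cxEnd_star`);
* `spannedByIsometries_of_scalarOnTranscendental` — `ScalarOnT[X, φ] → SpIso[X, φ]` (`k = 1`, `g = id`);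
* `scalarOnTranscendental_of_spannedByIsometries_of_not_cm` — `SpIso[X, φ] → ¬ CMX[X, φ, z] → ScalarOnT[X, φ]`: each
  spanning isometry `gᵢ` has `gᵢσ = tᵢσ` with `tᵢ` REAL (else `CMX`), `|tᵢ|² = 1` (isometry at `(σ, σ̄)`,
  `q(z, z̄) ≠ 0`), so `tᵢ = ±1 ∈ ℚ` and `gᵢ = tᵢ` on the `T`-domain; hence `f = Σ cᵢtᵢ ∈ ℚ` there;
* `spannedByIsometries_iff_scalar_or_cm` — **`SpIso[X, φ] ↔ (ScalarOnT[X, φ] ∨ CMX[X, φ, z])`** (the CM direction is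
  the tree's `spannedByIsometries_of_cm`).

With «RM-GEN»/«RM-EXACT» (`…LowPicardRMCells` :385 `¬ SpIso ⟺ ∃ d ≥ 2, RMgen`) this is the route's TRICHOTOMY as a
theorem: every marked projective `K3^{[2]}`-type `X` is exactly one of — Hodge-scalar (`E = ℚ`), CM, or genuine real
multiplication with a generator of degree `d ≥ 2` (the six cells at `ρ(X) ≤ 3`). No definition, no sorry, no named-fact
hypothesis. Prover seat hodge-nonav-20241-p1 (gen 14), `--supports stmt-HodgeConjecture-19653`. Nothing here proves HC.

References: Yu. Zarhin, J. reine angew. Math. 341 (1983) Thm. 1.5.1, Thm. 1.6; D. Huybrechts, *Lectures on K3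
Surfaces*, Ch. 3 Thm. 3.3.7, Cor. 3.3.6, Lemma 3.3.1; C. Voisin, *Hodge Theory I*, §7.1.1.
-/

noncomputable section

set_option linter.dupNamespace false

open scoped TensorProduct
open Module CategoryTheory
open Literature.AlgebraicTopology.SingularHomology Literature.Geometry.Kaehler
open Literature.AlgebraicGeometry Literature.AlgebraicGeometry.Motives Literature.AlgebraicGeometry.HodgeTheory
open Literature.AlgebraicGeometry.Motives.HodgeStructure
open Literature.AlgebraicGeometry.Hyperkaehler Literature.AlgebraicGeometry.Surfaces
open Summit.HodgeConjecture.HodgeConjecture.Theorems.NikulinTwinTransport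
open Summit.HodgeConjecture.HodgeConjecture.Theorems.MarkmanPartnerTransport.BBFPositivity
open Summit.HodgeConjecture.HodgeConjecture.Theorems.MarkmanPartnerTransport.LatticeBridge

namespace Summit.HodgeConjecture.HodgeConjecture.Theorems.MarkmanPartnerTransport.PartnerLattice

/-- `MarkedK3Sq[X, φ, P, z]`: VERBATIM the `let MarkedK3Sq := …` binder of the route declarations of
MarkmanPartnerTransport (clauses (m1)–(m6)). Local notation only. -/
local notation3 (prettyPrint := false) "MarkedK3Sq[" X ", " φ ", " P ", " z "]" =>
  (((IsIntegralClass P ∧ ∀ Q : complexBetti X (2 * 4), IsIntegralClass Q → ∃ n : ℤ, Q = n • P) ∧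
    (∀ c : complexBetti X 2, IsIntegralClass c ↔ ∃ v : K3HilbertIndex → ℤ, φ c = fun i => (v i : ℂ)) ∧
    (∀ a : complexBetti X 2, cupPowTwo a 4 = ((3 : ℂ) * (k3HilbertForm 2 (φ a) (φ a)) ^ 2) • P) ∧
    (IsOfHodgeType 4 X 2 2 0 (LinearEquiv.symm φ z) ∧
      ∀ τ : complexBetti X 2, IsOfHodgeType 4 X 2 2 0 τ → ∃ t : ℂ, τ = t • LinearEquiv.symm φ z) ∧
    (∀ c : complexBetti X 2, IsOfHodgeType 4 X 2 1 1 c ↔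
      (k3HilbertForm 2 (φ c) z = 0 ∧ k3HilbertForm 2 (φ c) (star z) = 0)) ∧
    (k3HilbertForm 2 z z = 0 ∧ 0 < (k3HilbertForm 2 (star z) z).re)))

/-- `SpIso[X, φ]`: VERBATIM the `let SpannedByIsometries := …` binder of the route declarations (with
`IsBBFTransc` unfolded). Local notation only. -/
local notation3 (prettyPrint := false) "SpIso[" X ", " φ "]" =>
  (∀ f : complexBetti X 2 →ₗ[ℂ] complexBetti X 2, (∀ y, IsRationalClass y → IsRationalClass (f y)) →
    (∀ (i j : ℕ) y, IsOfHodgeType 4 X 2 i j y → IsOfHodgeType 4 X 2 i j (f y)) →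
    (∀ d : complexBetti X 2, d ∈ algebraicClasses X 1 → f d = 0) →
    (∀ y : complexBetti X 2, ∀ d : complexBetti X 2, d ∈ algebraicClasses X 1 →
      k3HilbertForm 2 (φ (f y)) (φ d) = 0) →
    ∃ (k : ℕ) (c : Fin k → ℚ) (g : Fin k → (complexBetti X 2 →ₗ[ℂ] complexBetti X 2)),
      (∀ i, Function.Bijective (g i) ∧ (∀ y, IsRationalClass y → IsRationalClass (g i y)) ∧
        (∀ (a b : ℕ) y, IsOfHodgeType 4 X 2 a b y → IsOfHodgeType 4 X 2 a b (g i y)) ∧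
        (∀ a b, k3HilbertForm 2 (φ (g i a)) (φ (g i b)) = k3HilbertForm 2 (φ a) (φ b))) ∧
      ∀ y : complexBetti X 2, (∀ d : complexBetti X 2, d ∈ algebraicClasses X 1 →
        k3HilbertForm 2 (φ y) (φ d) = 0) → f y = ∑ i : Fin k, ((c i : ℂ) • g i y))

/-- `CMX[X, φ, z]`: "`X` has complex multiplication" in marking coordinates (VERBATIM `…K3Sq2OneCycle`): a rational
endomorphism of `H²(X(ℂ); ℂ)` preserving type `(1,1)` with a NON-REAL eigenvalue on `σ = φ⁻¹ z`. Local notation only. -/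
local notation3 (prettyPrint := false) "CMX[" X ", " φ ", " z "]" =>
  (∃ Ψ : complexBetti X 2 →ₗ[ℂ] complexBetti X 2, (∀ y, IsRationalClass y → IsRationalClass (Ψ y)) ∧
    (∀ y, IsOfHodgeType 4 X 2 1 1 y → IsOfHodgeType 4 X 2 1 1 (Ψ y)) ∧
    ∃ μ : ℂ, μ.im ≠ 0 ∧ Ψ (LinearEquiv.symm φ z) = μ • LinearEquiv.symm φ z)

/-- `ScalarOnT[X, φ]`: "the Hodge endomorphisms of `T(X)` are the rational scalars" (`E(X) = ℚ`) in marking coordinates —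
every rational Hodge endomorphism of `H²(X)` killing `N¹(X)` with `q`-transcendental image (the hypotheses of
`SpannedByIsometries`) is a RATIONAL SCALAR on the `T`-domain. Local notation only. -/
local notation3 (prettyPrint := false) "ScalarOnT[" X ", " φ "]" =>
  (∀ f : complexBetti X 2 →ₗ[ℂ] complexBetti X 2, (∀ y, IsRationalClass y → IsRationalClass (f y)) →
    (∀ (i j : ℕ) y, IsOfHodgeType 4 X 2 i j y → IsOfHodgeType 4 X 2 i j (f y)) →
    (∀ d : complexBetti X 2, d ∈ algebraicClasses X 1 → f d = 0) →
    (∀ y : complexBetti X 2, ∀ d : complexBetti X 2, d ∈ algebraicClasses X 1 →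
      k3HilbertForm 2 (φ (f y)) (φ d) = 0) →
    ∃ a : ℚ, ∀ y : complexBetti X 2, (∀ d : complexBetti X 2, d ∈ algebraicClasses X 1 →
      k3HilbertForm 2 (φ y) (φ d) = 0) → f y = (a : ℂ) • y)

/-- `qQ`: the rational Beauville–Bogomolov form on `ℚ²³`. -/
local notation3 (prettyPrint := false) "qQ" => Matrix.toBilin' (Matrix.map (k3HilbertGram 2) (Int.cast : ℤ → ℚ))

/-- `qC`: the complex Beauville–Bogomolov form on `ℂ²³`. -/
local notation3 (prettyPrint := false) "qC" => Matrix.toBilin' (Matrix.map (k3HilbertGram 2) (Int.cast : ℤ → ℂ))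

variable {X : SchemeOver ℂ} {φ : complexBetti X 2 ≃ₗ[ℂ] (K3HilbertIndex → ℂ)} {P : complexBetti X (2 * 4)}
  {z : K3HilbertIndex → ℂ}

/-! ### A rational Hodge endomorphism with a RATIONAL eigenvalue on `σ` is that scalar on `T(X)` -/

/-- **A rational, `(1,1)`-type-preserving endomorphism `G` of `H²(X(ℂ); ℂ)` with `G σ = a · σ`, `a ∈ ℚ`, is the scalar
`a` on the `T`-domain.** Marking picture: `G` reads in the endomorphism field `E = End_Hdg(T)` of the period datum as
`r` with `ε(r) = a = ε(a · 1)` (`exists_ratEnd_of_eigen_of_oneOne`, `restrict_mem_endAlg`); the `(2,0)`-character `ε`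
is injective (Zarhin), so `r = a · 1`, i.e. `G = a` on `T_ℚ`, transported to `T(X)_ℂ = ι_T(ℂ ⊗ T)`.
[cite: Zarhin1983HodgeGroupsK3, Thm. 1.5.1] [cite: Huybrechts2016K3, Ch. 3 Cor. 3.3.6 and Lemma 3.3.1] -/
theorem eq_ratSmul_on_transcendental_of_apply_period (hX : IsSmoothProjective 4 X) (hM : MarkedK3Sq[X, φ, P, z])
    (G : complexBetti X 2 →ₗ[ℂ] complexBetti X 2) (hGrat : ∀ y, IsRationalClass y → IsRationalClass (G y))
    (hG11 : ∀ y, IsOfHodgeType 4 X 2 1 1 y → IsOfHodgeType 4 X 2 1 1 (G y)) {a : ℚ}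
    (hGσ : G (LinearEquiv.symm φ z) = (a : ℂ) • LinearEquiv.symm φ z) :
    ∀ y : complexBetti X 2, (∀ d : complexBetti X 2, d ∈ algebraicClasses X 1 → k3HilbertForm 2 (φ y) (φ d) = 0) →
      G y = (a : ℂ) • y := by
  classical
  obtain ⟨-, hint, -, ⟨hz20, hz20'⟩, h11, hzz, hzpos⟩ := id hM
  obtain ⟨NQ, hNQ⟩ := exists_ratNeronSeveri (X := X) φ
  set D := periodDatum hX hM hNQ with hDdef
  have hDT : D.T = (qQ).orthogonal NQ := rfl
  have hDx : D.x = z := rfl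
  have hDBC : ∀ a b, D.BC a b = k3HilbertForm 2 a b := fun a b => qC_apply a b
  clear_value D
  have hzne : z ≠ 0 := by
    intro h0
    rw [h0, k3HilbertForm_eq_dotProduct] at hzpos
    simp at hzpos
  set H := D.hodgeT with hH
  have hK3 : H.IsOfK3Type := D.isOfK3Type_hodgeT
  have hirr : H.IsIrreducible := D.isIrreducible_hodgeT
  obtain ⟨-, ε, hεinj, hε⟩ := Zarhin1983_endAlg_isField_holds H hirr hK3
  have hω : D.omega ∈ H.piece 2 0 := D.omega_mem_piece
  -- read `G` in `E`
  obtain ⟨τ, hτM, hτx, hτ11⟩ := exists_ratEnd_of_eigen_of_oneOne hX hM G hGrat ⟨(a : ℂ), hGσ⟩ hG11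
  have hτx' : ∃ c : ℂ, cxEnd τ D.x = c • D.x := by rw [hDx]; exact hτx
  have hτ11' : ∀ w : K3HilbertIndex → ℂ, D.BC w D.x = 0 → D.BC w (star D.x) = 0 →
      D.BC (cxEnd τ w) D.x = 0 ∧ D.BC (cxEnd τ w) (star D.x) = 0 := by
    intro w h1 h2
    rw [hDBC, hDx] at h1 h2
    rw [hDBC, hDBC, hDx]
    exact hτ11 w h1 h2
  have hτT : ∀ t ∈ D.T, τ t ∈ D.T := fun t ht => D.map_mem_T τ hτx' ht
  have hr : τ.restrict hτT ∈ H.endAlg := D.restrict_mem_endAlg τ hτT hτx' hτ11'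
  have hτMapp : ∀ v, cxEnd τ v = φ (G (φ.symm v)) := fun v => by rw [hτM]; rfl
  -- `ε(G|_T) = a`
  have hεr : ε ⟨τ.restrict hτT, hr⟩ = (a : ℂ) := by
    have h := hε ⟨τ.restrict hτT, hr⟩ D.omega hω
    have h2 := congrArg (iota D.T) h
    have hval : ((⟨τ.restrict hτT, hr⟩ : H.endAlg) : Module.End ℚ ↥D.T) = τ.restrict hτT := rfl
    rw [hval, D.iota_baseChange_restrict τ hτT, D.iota_omega, map_smul, D.iota_omega, hDx, hτMapp, hGσ, map_smul,
      LinearEquiv.apply_symm_apply] at h2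
    have h3 : ((a : ℂ) - ε ⟨τ.restrict hτT, hr⟩) • z = 0 := by rw [sub_smul, h2, sub_self]
    rcases smul_eq_zero.1 h3 with h4 | h4
    · exact (sub_eq_zero.1 h4).symm
    · exact absurd h4 hzne
  -- `ε` injective: `G|_T = a · 1`
  have hra : (⟨τ.restrict hτT, hr⟩ : H.endAlg) = algebraMap ℚ H.endAlg a := by
    apply hεinj
    rw [hεr, AlgHom.commutes, eq_ratCast]
  have hTeq : ∀ t' : ↥D.T, τ (t' : K3HilbertIndex → ℚ) = a • (t' : K3HilbertIndex → ℚ) := by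
    intro t'
    have h1 := congrArg (fun s : H.endAlg => ((s : Module.End ℚ ↥D.T) t' : K3HilbertIndex → ℚ)) hra
    simp only at h1
    rw [LinearMap.coe_restrict_apply, Subalgebra.coe_algebraMap, Module.algebraMap_end_apply, Submodule.coe_smul] at h1
    exact h1
  -- transport to `T(X)_ℂ`
  have hcx : ∀ w : ℂ ⊗[ℚ] ↥D.T, cxEnd τ (iota _ w) = (a : ℂ) • iota _ w := by
    intro w
    induction w using TensorProduct.induction_on with
    | zero => rw [map_zero, map_zero, smul_zero]
    | tmul c t' => rw [iota_tmul, map_smul, cxEnd_ratVec, hTeq t', ratCastVec_smul, smul_comm]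
    | add z₁ z₂ h₁ h₂ => rw [map_add, map_add, h₁, h₂, smul_add]
  intro y hy
  have hyT : φ y ∈ Submodule.span ℂ (Set.range fun t : ↥D.T => fun i => (((t : K3HilbertIndex → ℚ) i : ℚ) : ℂ)) := by
    have h := (mem_span_ratTransc_iff hX hint hNQ (φ y)).2 hy
    rw [Set.image_eq_range] at h
    rw [hDT]
    exact h
  have hzι : iota _ (lam D.isCompl (φ y)) = φ y := iota_lam_of_mem_span D.isCompl hyT
  have hGy : G y = φ.symm (cxEnd τ (φ y)) := by
    rw [hτMapp, LinearEquiv.symm_apply_apply, LinearEquiv.symm_apply_apply]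
  rw [hGy, ← hzι, hcx, hzι, map_smul, LinearEquiv.symm_apply_apply]

/-! ### A rational endomorphism commutes with complex conjugation -/

/-- **`φ(G σ̄) = conj(t) · z̄` when `G σ = t · σ`** for a rational, `(1,1)`-type-preserving `G`: `G` is the
complexification of a rational endomorphism of `ℚ²³` (`exists_ratEnd_of_eigen_of_oneOne`), which commutes with complex
conjugation of the coordinates (`cxEnd_star`). [cite: VoisinHodgeI2002, §7.1.1] [cite: Huybrechts2016K3, Ch. 3 §2.2] -/
theorem apply_conjPeriod_of_apply_period (hX : IsSmoothProjective 4 X) (hM : MarkedK3Sq[X, φ, P, z])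
    (G : complexBetti X 2 →ₗ[ℂ] complexBetti X 2) (hGrat : ∀ y, IsRationalClass y → IsRationalClass (G y))
    (hG11 : ∀ y, IsOfHodgeType 4 X 2 1 1 y → IsOfHodgeType 4 X 2 1 1 (G y)) {t : ℂ}
    (hGσ : G (LinearEquiv.symm φ z) = t • LinearEquiv.symm φ z) :
    φ (G (LinearEquiv.symm φ (star z))) = starRingEnd ℂ t • star z := by
  obtain ⟨τ, hτM, -, -⟩ := exists_ratEnd_of_eigen_of_oneOne hX hM G hGrat ⟨t, hGσ⟩ hG11
  have hτMapp : ∀ v, cxEnd τ v = φ (G (φ.symm v)) := fun v => by rw [hτM]; rfl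
  rw [← hτMapp, cxEnd_star, hτMapp, hGσ, map_smul, LinearEquiv.apply_symm_apply, star_smul]
  rfl

/-! ### The trichotomy -/

/-- **`E(X) = ℚ` ⟹ `SpannedByIsometries`**: if every admissible Hodge endomorphism is a rational scalar `a` on the
`T`-domain, it is the `ℚ`-combination `a · id` of the single (bijective, rational, type-preserving) isometry `id`.
[folklore] -/
theorem spannedByIsometries_of_scalarOnTranscendental (h : ScalarOnT[X, φ]) : SpIso[X, φ] := by
  intro f hf1 hf2 hf3 hf4
  obtain ⟨a, ha⟩ := h f hf1 hf2 hf3 hf4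
  refine ⟨1, fun _ => a, fun _ => LinearMap.id, fun _ => ⟨⟨fun x y hxy => hxy, fun y => ⟨y, rfl⟩⟩,
    fun y hy => hy, fun a b y hy => hy, fun a b => rfl⟩, fun y hy => ?_⟩
  rw [Fin.sum_univ_one, LinearMap.id_apply]
  exact ha y hy

/-- **`SpannedByIsometries` without complex multiplication ⟹ `E(X) = ℚ`.** Every spanning isometry `gᵢ` has
`gᵢ σ = tᵢ σ` with `tᵢ` REAL (a non-real `tᵢ` would be `CMX`), and `|tᵢ|² q(z, z̄) = q(z, z̄)` (isometry at `(σ, σ̄)`,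
`apply_conjPeriod_of_apply_period`) with `q(z, z̄) ≠ 0` ((m6)), so `tᵢ = ±1 ∈ ℚ` and `gᵢ = tᵢ` on the `T`-domain
(`eq_ratSmul_on_transcendental_of_apply_period`); hence `f = Σ cᵢgᵢ = (Σ cᵢtᵢ) · id` there, a rational scalar.
[cite: Zarhin1983HodgeGroupsK3, Thm. 1.5.1 and Thm. 1.6] [cite: Huybrechts2016K3, Ch. 3 Thm. 3.3.7] -/
theorem scalarOnTranscendental_of_spannedByIsometries_of_not_cm (hX : IsSmoothProjective 4 X)
    (hM : MarkedK3Sq[X, φ, P, z]) (hsp : SpIso[X, φ]) (hcm : ¬ CMX[X, φ, z]) : ScalarOnT[X, φ] := by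
  classical
  obtain ⟨-, hint, -, ⟨hz20, hz20'⟩, h11, hzz, hzpos⟩ := id hM
  have hq0 : k3HilbertForm 2 z (star z) ≠ 0 := by
    intro h0
    rw [k3HilbertForm_comm] at h0
    rw [h0, Complex.zero_re] at hzpos
    exact lt_irrefl _ hzpos
  intro f hf1 hf2 hf3 hf4
  obtain ⟨k, c, g, hg, hf⟩ := hsp f hf1 hf2 hf3 hf4
  -- (a) eigenvalues on `σ`
  have ht : ∀ i : Fin k, ∃ t : ℂ, g i (LinearEquiv.symm φ z) = t • LinearEquiv.symm φ z :=
    fun i => hz20' _ ((hg i).2.2.1 2 0 _ hz20)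
  choose t ht using ht
  have hg11 : ∀ (i : Fin k) y, IsOfHodgeType 4 X 2 1 1 y → IsOfHodgeType 4 X 2 1 1 (g i y) :=
    fun i y hy => (hg i).2.2.1 1 1 y hy
  -- (b) real: otherwise `CMX`
  have hreal : ∀ i : Fin k, starRingEnd ℂ (t i) = t i := by
    intro i
    by_contra hne
    exact hcm ⟨g i, (hg i).2.1, hg11 i, t i, fun him => hne (Complex.conj_eq_iff_im.2 him), ht i⟩
  -- (c) `|tᵢ|² = 1`, hence `tᵢ² = 1`, `tᵢ = ±1`
  have hsq : ∀ i : Fin k, t i * t i = 1 := by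
    intro i
    have hiso := (hg i).2.2.2 (LinearEquiv.symm φ z) (LinearEquiv.symm φ (star z))
    rw [apply_conjPeriod_of_apply_period hX hM (g i) (hg i).2.1 (hg11 i) (ht i), ht i, map_smul,
      LinearEquiv.apply_symm_apply, LinearEquiv.apply_symm_apply, k3HilbertForm_smul_left, k3HilbertForm_smul_right,
      hreal i, ← mul_assoc] at hiso
    have h1' : t i * t i * k3HilbertForm 2 z (star z) = 1 * k3HilbertForm 2 z (star z) := by rw [hiso, one_mul]
    exact mul_right_cancel₀ hq0 h1'
  have hpm : ∀ i : Fin k, t i = 1 ∨ t i = -1 := fun i => mul_self_eq_one_iff.1 (hsq i)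
  obtain ⟨s, hs⟩ : ∃ s : Fin k → ℚ, ∀ i, t i = (s i : ℂ) := by
    refine ⟨fun i => if t i = 1 then 1 else -1, fun i => ?_⟩
    dsimp only
    split_ifs with h
    · rw [h, Rat.cast_one]
    · rcases hpm i with h' | h'
      · exact absurd h' h
      · rw [h', Rat.cast_neg, Rat.cast_one]
  -- (d) each `gᵢ` is the scalar `sᵢ` on the `T`-domain
  have hgT : ∀ (i : Fin k) (y : complexBetti X 2),
      (∀ d : complexBetti X 2, d ∈ algebraicClasses X 1 → k3HilbertForm 2 (φ y) (φ d) = 0) →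
        g i y = (s i : ℂ) • y :=
    fun i => eq_ratSmul_on_transcendental_of_apply_period hX hM (g i) (hg i).2.1 (hg11 i) (by rw [← hs i]; exact ht i)
  -- (e) `f = Σ cᵢ sᵢ` on the `T`-domain
  refine ⟨∑ i : Fin k, c i * s i, fun y hy => ?_⟩
  rw [hf y hy]
  simp_rw [hgT _ y hy, smul_smul]
  rw [← Finset.sum_smul]
  push_cast
  rfl

/-- **TRICHOTOMY: `SpannedByIsometries` holds exactly when the Hodge endomorphisms of `T(X)` are rational scalars or
`X` has complex multiplication** — `SpIso[X, φ] ↔ (ScalarOnT[X, φ] ∨ CMX[X, φ, z])` for every marked smooth projective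
`(X, φ, P, z)` (`spannedByIsometries_of_scalarOnTranscendental`, the tree's `spannedByIsometries_of_cm`, and
`scalarOnTranscendental_of_spannedByIsometries_of_not_cm`). With `not_spannedByIsometries_iff_exists_rmGenerator`
(`…LowPicardRMCells` :385) the three sectors «`E = ℚ`», «CM», «RM with a generator of degree `d ≥ 2`» are exhaustive
and the last is disjoint from the first two. [cite: Zarhin1983HodgeGroupsK3, Thm. 1.5.1 and Thm. 1.6]
[cite: Huybrechts2016K3, Ch. 3 Thm. 3.3.7 and Cor. 3.3.6] -/
theorem spannedByIsometries_iff_scalar_or_cm (hX : IsSmoothProjective 4 X) (hM : MarkedK3Sq[X, φ, P, z]) :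
    SpIso[X, φ] ↔ (ScalarOnT[X, φ] ∨ CMX[X, φ, z]) := by
  classical
  refine ⟨fun hsp => ?_, fun h => ?_⟩
  · by_cases hcm : CMX[X, φ, z]
    · exact Or.inr hcm
    · exact Or.inl (scalarOnTranscendental_of_spannedByIsometries_of_not_cm hX hM hsp hcm)
  · rcases h with h | ⟨Ψ, hΨrat, hΨ11, μ, hμ, hΨσ⟩
    · exact spannedByIsometries_of_scalarOnTranscendental h
    · exact spannedByIsometries_of_cm hX hM Ψ hΨrat hΨ11 hΨσ hμ

end Summit.HodgeConjecture.HodgeConjecture.Theorems.MarkmanPartnerTransport.PartnerLattice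

end
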